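import Mathlib.Algebra.MvPolynomial.PDeriv
import Mathlib.LinearAlgebra.Matrix.Determinant.Basic
import Literature.ModelTheory.PseudofiniteFields.NonsingularZerosFinite
import Literature.ModelTheory.PseudofiniteFields.TriangularCharts
import HarnessLib

/-!
# Fibres of triangular charts over the free coordinates are finite

Topic `Literature/ModelTheory/PseudofiniteFields`.  Proof-only companion of
`TriangularCharts.lean` (triangular charts `{D_j(u, w) = 0, ∂D_j/∂w_j ≠ 0}`, `∂D_j/∂w_i = 0` for
`i < j`, Jacobian determinant `∏_j ∂D_j/∂w_j`: `SmoothDatum.det_pderiv_of_triangular`) and of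
`NonsingularZerosFinite.lean` (`finite_nonsingular_zeros`: a square polynomial system over a field
has finitely many nonsingular zeros [Iversen1973, Prop. I.2.8]).  In the chart induction for
definable sets over pseudo-finite fields (Z. Chatzidakis, L. van den Dries, A. Macintyre,
*Definable sets over finite fields*, J. reine angew. Math. 427 (1992) [ChatzidakisVanDenDriesMacintyre1992],
Prop. 2.7) one needs that the projection of a triangular chart to its free coordinates `u` has
FINITE fibres: each bound coordinate `w_j` is a simple root of a one-variable polynomial once
`u, w_0, …, w_{j-1}` are fixed.

**Theorem** (`finite_triangularChart_fibre`).  Let `K` be a field, `D_1, …, D_k ∈ K[u, w]`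
(`u = Sum.inl : Fin e`, `w = Sum.inr : Fin k`) with `∂D_j/∂w_i = 0` for `i < j`, and `u ∈ K^e`.
Then `{w ∈ K^k | D(u, w) = 0, (∂D_j/∂w_j)(u, w) ≠ 0 for all j}` is finite.

PROOF (as formalised): specialise the free coordinates, `g_j(w) := D_j(u, w) ∈ K[w]` (the
`K`-algebra map `X_{inl i} ↦ u_i`, `X_{inr j} ↦ X_j`); this commutes with evaluation
(`eval_specializeInl`) and with `∂/∂w_j` (`pderiv_specializeInl`), so the Jacobian matrix of `g`
is the specialised (upper triangular) Jacobian matrix of `D` in the bound variables, with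
determinant `∏_j (∂D_j/∂w_j)(u, ·)`; hence our set is contained in the set of nonsingular zeros
of the square system `g`, which is finite by `finite_nonsingular_zeros`.

## References

* [ChatzidakisVanDenDriesMacintyre1992] Z. Chatzidakis, L. van den Dries, A. Macintyre,
  Definable sets over finite fields, J. reine angew. Math. 427 (1992) 107–135, Prop. 2.7.
* [Iversen1973] B. Iversen, Generic Local Structure of the Morphisms in Commutative Algebra,
  Lecture Notes in Math. 310, Springer 1973, Prop. I.2.8.

## Not here

The chart induction itself; positive-dimensional fibres; uniform bounds on the fibre size.
-/

namespace Literature.ModelTheory.PseudofiniteFields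

open MvPolynomial

section CommRing

variable {K : Type*} [CommRing K] {e k : ℕ}

/-- **Specialising the free coordinates commutes with evaluation**: evaluating
`D(u, X) ∈ K[w]` at `w` is evaluating `D` at `(u, w)`. [folklore] -/
theorem eval_specializeInl (u : Fin e → K) (w : Fin k → K)
    (p : MvPolynomial (Fin e ⊕ Fin k) K) :
    eval w (aeval (Sum.elim (fun i => C (u i)) X) p) = eval (Sum.elim u w) p := by
  induction p using MvPolynomial.induction_on with
  | C a => simp
  | add p q hp hq => simp [hp, hq]
  | mul_X p s hp => rcases s with i | j <;> simp [hp]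

/-- **Specialising the free coordinates commutes with the bound partial derivatives**:
`∂/∂w_j (D(u, X)) = (∂D/∂w_j)(u, X)`. [folklore] -/
theorem pderiv_specializeInl (u : Fin e → K) (j : Fin k) (p : MvPolynomial (Fin e ⊕ Fin k) K) :
    pderiv j (aeval (Sum.elim (fun i => C (u i)) X) p) =
      aeval (Sum.elim (fun i => C (u i)) X) (pderiv (Sum.inr j) p) := by
  induction p using MvPolynomial.induction_on with
  | C a => simp
  | add p q hp hq => simp [hp, hq]
  | mul_X p s hp =>
    rcases s with i | j'
    · simp [hp, Derivation.leibniz]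
    · simp only [map_mul, Derivation.leibniz, smul_eq_mul, map_add, hp, aeval_X, Sum.elim_inr,
        pderiv_X, Pi.single_apply, Sum.inr.injEq]
      split_ifs <;> simp

end CommRing

section Field

variable {K : Type*} [Field K] {e k : ℕ}

/-- **Fibres of a triangular chart over its free coordinates are finite**: for
`D_1, …, D_k ∈ K[u, w]` over a field with `∂D_j/∂w_i = 0` for `i < j` and a fixed `u ∈ K^e`, the
set `{w ∈ K^k | D(u, w) = 0 ∧ ∀ j, (∂D_j/∂w_j)(u, w) ≠ 0}` is finite: it consists of nonsingular
zeros of the square system `g_j = D_j(u, ·)`, whose Jacobian determinant is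
`∏_j (∂D_j/∂w_j)(u, ·)` by triangularity.
[cite: ChatzidakisVanDenDriesMacintyre1992, Prop. 2.7 (finite fibres of the charts)] -/
theorem finite_triangularChart_fibre (D : Fin k → MvPolynomial (Fin e ⊕ Fin k) K)
    (htri : ∀ j i : Fin k, i < j → pderiv (Sum.inr i) (D j) = 0) (u : Fin e → K) :
    {w : Fin k → K | (∀ j, eval (Sum.elim u w) (D j) = 0) ∧
      ∀ j, eval (Sum.elim u w) (pderiv (Sum.inr j) (D j)) ≠ 0}.Finite := by
  classical
  set φ : MvPolynomial (Fin e ⊕ Fin k) K →ₐ[K] MvPolynomial (Fin k) K :=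
    aeval (Sum.elim (fun i => C (u i)) X) with hφ
  refine (finite_nonsingular_zeros fun j => φ (D j)).subset ?_
  rintro w ⟨hw0, hw1⟩
  refine ⟨fun j => ?_, ?_⟩
  · rw [hφ, eval_specializeInl]
    exact hw0 j
  · have hM : (Matrix.of fun i j : Fin k => pderiv j (φ (D i))) =
        φ.mapMatrix (Matrix.of fun i j : Fin k => pderiv (Sum.inr j) (D i)) := by
      ext i j
      simp only [Matrix.of_apply, AlgHom.mapMatrix_apply, Matrix.map_apply, hφ,
        pderiv_specializeInl]
    rw [hM, ← AlgHom.map_det, SmoothDatum.det_pderiv_of_triangular D htri, map_prod, map_prod,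
      Finset.prod_ne_zero_iff]
    intro j _
    rw [hφ, eval_specializeInl]
    exact hw1 j

end Field

end Literature.ModelTheory.PseudofiniteFields
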